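import Literature.AlgebraicGeometry.HodgeTheory.FermatHodgeCharacterUGroup
import Literature.AlgebraicGeometry.HodgeTheory.FermatHodgeCharacterFibre
import HarnessLib

/-!
# Length-3 elements of Aoki's ideal `A(f)` (Aoki 1983, Prop. 8.1)

Support file VIII (everything PROVED; no named facts, no definitions) for the structure theorem of
the Hodge characters of the Fermat surface (`AokiShioda1983_thmB2m_standard`).

**Main result** (`triple_structure`): let `f` be odd or divisible by `4`, with
`f ∉ {1, 12, 15, 20, 21, 28}`, and let `a, b ∈ (ℤ/f)ˣ` satisfy `1 + χ(a) + χ(b) = 0` for every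
odd primitive Dirichlet character `χ` mod `f` (i.e. `(1) + (a) + (b) ∈ A(f)` in Aoki's notation).
Then `9 ∣ f` and there is `c ≡ 1 (mod f/3)`, `c ≠ 1` (so `{1, c, c²} = ker((ℤ/f)ˣ → (ℤ/(f/3))ˣ)`)
with `a ∈ c · {1, u}` and `b ∈ c² · {1, u}` (`u = f/2 - 1`, present only when `4 ∣ f`): the
triple is Aoki's "`3`-quasi-standard" element up to the invisible factors `u ∈ U(f)`
([Aoki1983, Prop. 8.1 (ii)]); the levels `21, 28` are the genuine exceptions of
[Aoki1983, Prop. 8.1 (i)] (e.g. `(1) + (4) + (16) ∈ A(21)`).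

**Proof** (by values of characters, replacing Aoki's Props. 6.4–6.6 / Lemma 7.2): three complex
numbers of modulus one with sum zero are `z, zω, zω²`; hence `χ(a)³ = 1 ≠ χ(a)` and
`χ(b) = χ(a)²` for all `χ ∈ PC⁻(f)`, so `a³ ∈ U(f) = {1, u, v, uv}` (Prop. 6.1, file `UGroup`),
`a⁶ = 1`, and `c := a⁴` satisfies `c³ = 1`, `χ(c) = χ(a) ≠ 1`. If some local component `c_p`
(`p ≠ 3`) were non-trivial it would have order `3`, and fibre counting (file `Fibre`) produces
an odd primitive `χ` with `χ(c) = 1` — unless `p^e = 7` and `f/7 ∈ {3, 4}`. So `c ≡ 1` modulo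
every `p^e ∥ f`, `p ≠ 3`, and modulo `3^(e-1)` (cubes in `(ℤ/3^e)ˣ`), i.e. `c ≡ 1 (mod f/3)`.

## References

* [Aoki1983] N. Aoki, On some arithmetic problems related to the Hodge cycles on the Fermat
  varieties, Math. Ann. 266 (1983) 23–54, Prop. 8.1 (text read).
-/

noncomputable section

open Finset

namespace Literature.AlgebraicGeometry.HodgeTheory

namespace FermatCharacter

/-! ### Squares of the elements of `U(f)` -/

/-- `u² = 1` for `u = N/2 - 1`, `4 ∣ N`. [cite: Aoki1983, §6] -/
theorem uElt_sq {N : ℕ} (h4 : 4 ∣ N) : ((((N / 2 : ℕ) : ZMod N)) - 1) ^ 2 = 1 := by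
  obtain ⟨k, hk⟩ := h4
  have hN2 : N / 2 = 2 * k := by rw [hk]; omega
  have hsq0 : ((N / 2 : ℕ) : ZMod N) * ((N / 2 : ℕ) : ZMod N) = 0 := by
    rw [← Nat.cast_mul, ZMod.natCast_eq_zero_iff, hN2, hk]; exact ⟨k, by ring⟩
  have h2half : (2 : ZMod N) * ((N / 2 : ℕ) : ZMod N) = 0 := by
    rw [show (2 : ZMod N) = ((2 : ℕ) : ZMod N) by norm_cast, ← Nat.cast_mul,
      ZMod.natCast_eq_zero_iff, hN2, hk]
    exact ⟨1, by ring⟩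
  linear_combination hsq0 - h2half

/-- `v² = 1` for `v = 2(N/3)² - 1`, `3 ∥ N`. [cite: Aoki1983, §6] -/
theorem vElt_sq {N : ℕ} [NeZero N] (h3 : 3 ∣ N) (h9 : ¬ 9 ∣ N) :
    (2 * ((N / 3 : ℕ) : ZMod N) ^ 2 - 1) ^ 2 = 1 := by
  obtain ⟨k, hk⟩ := h3
  have hN3 : N / 3 = k := by rw [hk]; omega
  have hk3 : ¬ 3 ∣ k := fun ⟨j, hj⟩ ↦ h9 ⟨j, by rw [hk, hj]; ring⟩
  have hkey : (((N / 3 : ℕ) : ZMod N)) ^ 2 * ((((N / 3 : ℕ) : ZMod N)) ^ 2 - 1) = 0 := by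
    have h3k : 3 ∣ k ^ 2 + 2 := by
      rw [← ZMod.natCast_eq_zero_iff]
      push_cast
      have hk0 : (k : ZMod 3) ≠ 0 := by rw [Ne, ZMod.natCast_eq_zero_iff]; exact hk3
      generalize (k : ZMod 3) = y at hk0; revert y; decide
    obtain ⟨j, hj⟩ := h3k
    rw [hN3]
    have h1 : ((k : ℕ) : ZMod N) ^ 2 + 2 = 3 * (j : ZMod N) := by
      exact_mod_cast congrArg (Nat.cast (R := ZMod N)) hj
    have h2 : (3 : ZMod N) * (k : ZMod N) = 0 := by
      have : ((3 * k : ℕ) : ZMod N) = 0 := by rw [← hk]; exact ZMod.natCast_self N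
      push_cast at this; exact this
    linear_combination ((k : ZMod N) * (j : ZMod N) - (k : ZMod N)) * h2 + ((k : ZMod N)) ^ 2 * h1
  linear_combination (4 : ZMod N) * hkey

/-- Elements of `U(f)` square to `1` (`f ∉ {15, 20}` odd or `4 ∣ f`): `U(f) ⊆ {1, u, v, uv}` and
`u² = v² = 1`. [cite: Aoki1983, Prop. 6.1] -/
theorem sq_eq_one_of_forall_odd_isPrimitive {f : ℕ} [NeZero f] (hval : Odd f ∨ 4 ∣ f)
    (h15 : f ≠ 15) (h20 : f ≠ 20) (w : (ZMod f)ˣ)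
    (hw : ∀ χ : DirichletCharacter ℂ f, χ.Odd → χ.IsPrimitive → χ w = 1) :
    (w : ZMod f) ^ 2 = 1 := by
  rcases coe_eq_of_forall_odd_isPrimitive f hval h15 h20 w hw with
    h | ⟨h4, h⟩ | ⟨h3, h9, h⟩ | ⟨h4, h3, h9, h⟩
  · rw [h, one_pow]
  · rw [h, uElt_sq h4]
  · rw [h, vElt_sq h3 h9]
  · rw [h, mul_pow, uElt_sq h4, vElt_sq h3 h9, one_mul]

/-! ### Cubes in `(ℤ/3^e)ˣ` -/

/-- An element of `(ℤ/3^e)ˣ` with `x³ = 1` is `≡ 1 (mod 3^(e-1))`: writing `x = 1 + 3t`,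
`0 = x³ - 1 = 9t (3(t² + t) + 1)` with the last factor a unit. [folklore] -/
theorem unitsMap_eq_one_of_pow_three_eq_one {e : ℕ} (he : 1 ≤ e) (x : (ZMod (3 ^ e))ˣ)
    (hx : x ^ 3 = 1) : ZMod.unitsMap (pow_dvd_pow 3 (Nat.sub_le e 1)) x = 1 := by
  haveI : NeZero (3 ^ e) := ⟨pow_ne_zero e three_ne_zero⟩
  haveI : NeZero (3 ^ (e - 1)) := ⟨pow_ne_zero _ three_ne_zero⟩
  have h3e : (3 : ℕ) ∣ 3 ^ e := dvd_pow_self 3 (by omega)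
  set y : ZMod (3 ^ e) := (x : ZMod (3 ^ e)) with hy
  have hy3 : y ^ 3 = 1 := by
    have := congrArg (fun u : (ZMod (3 ^ e))ˣ ↦ (u : ZMod (3 ^ e))) hx
    simpa using this
  -- `y ≡ 1 (mod 3)`
  have hy1 : ((y - 1).cast : ZMod 3) = 0 := by
    rw [← ZMod.castHom_apply (h := h3e), map_sub, map_one]
    have h3' : (ZMod.castHom h3e (ZMod 3) y) ^ 3 = 1 := by rw [← map_pow, hy3, map_one]
    generalize ZMod.castHom h3e (ZMod 3) y = z at h3'
    revert z; decide
  rw [ZMod.cast_eq_val, ZMod.natCast_eq_zero_iff] at hy1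
  obtain ⟨t, ht⟩ := hy1
  -- `y = 1 + 3t`
  have hyt : y = 1 + 3 * (t : ZMod (3 ^ e)) := by
    have : ((y - 1 : ZMod (3 ^ e))) = ((3 * t : ℕ) : ZMod (3 ^ e)) := by
      rw [← ht, ZMod.natCast_zmod_val]
    push_cast at this
    linear_combination this
  -- `9 t (3(t² + t) + 1) = 0`
  have hprod : ((9 * t * (3 * (t ^ 2 + t) + 1) : ℕ) : ZMod (3 ^ e)) = 0 := by
    push_cast
    have : y ^ 3 - 1 = 0 := by rw [hy3, sub_self]
    rw [hyt] at this
    linear_combination this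
  rw [ZMod.natCast_eq_zero_iff] at hprod
  have hcop : Nat.Coprime (3 ^ e) (3 * (t ^ 2 + t) + 1) := by
    apply Nat.Coprime.pow_left
    rw [Nat.Prime.coprime_iff_not_dvd Nat.prime_three]
    omega
  have h9t : 3 ^ e ∣ 9 * t := hcop.dvd_of_dvd_mul_right hprod
  have h3t : 3 ^ (e - 1) ∣ 3 * t := by
    have h' : 3 * 3 ^ (e - 1) ∣ 3 * (3 * t) := by
      rw [← pow_succ', show e - 1 + 1 = e by omega, show 3 * (3 * t) = 9 * t by ring]
      exact h9t
    exact Nat.dvd_of_mul_dvd_mul_left (by norm_num) h'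
  apply Units.ext
  rw [coe_unitsMap, Units.val_one, ← hy, hyt, map_add, map_one, map_mul, map_natCast,
    map_ofNat, show (3 : ZMod (3 ^ (e - 1))) * (t : ZMod (3 ^ (e - 1))) =
      ((3 * t : ℕ) : ZMod (3 ^ (e - 1))) by push_cast; ring,
    (ZMod.natCast_eq_zero_iff _ _).mpr h3t, add_zero]

/-- In `(ℤ/3)ˣ` and `(ℤ/4)ˣ`... more generally: a unit of `ℤ/N` with `x³ = 1` reduces to `1`
mod `3` (`3 ∣ N`). [folklore] -/
theorem castHom_three_eq_one_of_pow_three {N : ℕ} (h3 : 3 ∣ N) (x : (ZMod N)ˣ) (hx : x ^ 3 = 1) :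
    ZMod.castHom h3 (ZMod 3) (x : ZMod N) = 1 := by
  have h3' : (ZMod.castHom h3 (ZMod 3) (x : ZMod N)) ^ 3 = 1 := by
    rw [← map_pow, ← Units.val_pow_eq_pow_val, hx, Units.val_one, map_one]
  generalize ZMod.castHom h3 (ZMod 3) (x : ZMod N) = z at h3'
  revert z; decide

/-! ### Consequences of the triple relation for the values of characters -/

/-- From `1 + χ(a) + χ(b) = 0`: `χ(a)` is a primitive cube root of unity, `χ(b) = χ(a)²`,
`χ(a³) = 1` and `χ(b a⁻²) = 1`. [cite: Aoki1983, Prop. 8.1] -/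
theorem charvals_of_triple {N : ℕ} [NeZero N] {a b : (ZMod N)ˣ} {χ : DirichletCharacter ℂ N}
    (h : 1 + χ a + χ b = 0) :
    χ a ^ 2 + χ a + 1 = 0 ∧ χ b = χ a ^ 2 ∧ χ ((a ^ 3 : (ZMod N)ˣ) : ZMod N) = 1 ∧
      χ ((b * (a ^ 2)⁻¹ : (ZMod N)ˣ) : ZMod N) = 1 := by
  have h' : χ ((1 : (ZMod N)ˣ) : ZMod N) + χ a + χ b = 0 := by rwa [Units.val_one, map_one]
  obtain ⟨hA, hB⟩ := char_cube_of_add_three_eq_zero χ 1 a b h'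
  simp only [inv_one, mul_one] at hA hB
  have ha0 : χ a ≠ 0 := fun h0 ↦ by
    have := DirichletCharacter.unit_norm_eq_one χ a
    rw [h0, norm_zero] at this
    exact zero_ne_one this
  refine ⟨hA, hB, ?_, ?_⟩
  · rw [Units.val_pow_eq_pow_val, map_pow]
    linear_combination (χ a - 1) * hA
  · rw [Units.val_mul, map_mul, map_units_inv, Units.val_pow_eq_pow_val, map_pow, hB,
      mul_inv_cancel₀ (pow_ne_zero 2 ha0)]

/-! ### Fibre counting at the level `7` -/

/-- At a level `p^e` with `φ(p^e) = 6` (i.e. `p^e = 7` or `9`): for `a` of order `3` every pair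
(parity `ε`, cube root `ζ`) except `(1, 1)` is realised by a NON-TRIVIAL character, which is
primitive when `p^e = 7`. [folklore] -/
theorem exists_isPrimitive_neg_one_apply_cube_seven {p e : ℕ} (hp : p.Prime) (h7 : p ^ e = 7)
    {a : (ZMod (p ^ e))ˣ} (ha : orderOf a = 3) {ε ζ : ℂ} (hε : ε = 1 ∨ ε = -1) (hζ : ζ ^ 3 = 1)
    (hne : ¬ (ε = 1 ∧ ζ = 1)) :
    ∃ χ : DirichletCharacter ℂ (p ^ e), χ.IsPrimitive ∧ χ (-1) = ε ∧ χ (a : ZMod (p ^ e)) = ζ := by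
  classical
  haveI : NeZero (p ^ e) := ⟨pow_ne_zero e hp.ne_zero⟩
  have he1 : e = 1 := by
    have h2 := hp.two_le
    rcases e with _ | _ | e
    · rw [pow_zero] at h7; omega
    · rfl
    · exfalso
      have h4 : p ^ 2 ∣ p ^ (e + 2) := pow_dvd_pow p (by omega)
      rw [h7] at h4
      have h9 : p ^ 2 ≤ 7 := Nat.le_of_dvd (by norm_num) h4
      have hp2 : p = 2 := by nlinarith
      subst hp2
      have : (2 : ℕ) ^ (e + 2) = 4 * 2 ^ e := by ring
      omega
  have h6 := orderOf_neg_of_orderOf_eq_three (by rw [h7]; norm_num) ha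
  have hz : (ε * ζ) ^ 6 = 1 := by
    rw [mul_pow, show (6 : ℕ) = 3 * 2 by norm_num, pow_mul ζ, hζ, one_pow, mul_one]
    rcases hε with rfl | rfl <;> norm_num
  have hcard := card_filter_apply_eq (-a) h6 (by norm_num) hz
  have htot : (p ^ e).totient = 6 := by rw [h7]; decide
  rw [htot] at hcard
  have hpos : 0 < #{χ : DirichletCharacter ℂ (p ^ e) | χ ((-a : (ZMod (p ^ e))ˣ) : ZMod (p ^ e)) = ε * ζ} := by
    omega
  obtain ⟨χ, hχ⟩ := Finset.card_pos.mp hpos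
  simp only [mem_filter, mem_univ, true_and] at hχ
  have hχ1 : χ ≠ 1 := by
    rintro rfl
    rw [MulChar.one_apply_coe] at hχ
    -- `1 = ε ζ` forces `ε = 1, ζ = 1`: `ζ = ε⁻¹ = ε`, `ζ³ = ε³ = ε = 1`
    have hζε : ζ = ε := by
      rcases hε with rfl | rfl
      · rw [one_mul] at hχ; exact hχ.symm
      · have : ζ = -1 := by linear_combination hχ
        exact this
    rw [hζε] at hζ
    rcases hε with rfl | rfl
    · exact hne ⟨rfl, hζε⟩
    · norm_num at hζ
  have hprim : χ.IsPrimitive := by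
    subst he1
    refine isPrimitive_of_not_factorsThrough_primePow hp le_rfl χ ?_
    rw [Nat.sub_self, pow_zero, DirichletCharacter.factorsThrough_one_iff]
    exact hχ1
  refine ⟨χ, hprim, ?_, ?_⟩
  · have hx3 : (a : ZMod (p ^ e)) ^ 3 = 1 := by
      have ha3 : a ^ 3 = 1 := by rw [← ha]; exact pow_orderOf_eq_one a
      have := congrArg (fun u : (ZMod (p ^ e))ˣ ↦ (u : ZMod (p ^ e))) ha3
      simpa using this
    have h3 : (-(a : ZMod (p ^ e))) ^ 3 = -1 := by rw [neg_pow, hx3]; norm_num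
    rw [Units.val_neg] at hχ
    calc χ (-1) = χ ((-(a : ZMod (p ^ e))) ^ 3) := by rw [h3]
      _ = (ε * ζ) ^ 3 := by rw [map_pow, hχ]
      _ = ε := by
        rw [mul_pow, hζ, mul_one]
        rcases hε with rfl | rfl <;> norm_num
  · have hx3 : (a : ZMod (p ^ e)) ^ 3 = 1 := by
      have ha3 : a ^ 3 = 1 := by rw [← ha]; exact pow_orderOf_eq_one a
      have := congrArg (fun u : (ZMod (p ^ e))ˣ ↦ (u : ZMod (p ^ e))) ha3
      simpa using this
    have h4 : (-(a : ZMod (p ^ e))) ^ 4 = a := by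
      rw [neg_pow, show (4 : ℕ) = 3 + 1 by norm_num, pow_add (a : ZMod (p ^ e)), hx3, one_mul,
        pow_one]
      norm_num
    rw [Units.val_neg] at hχ
    calc χ (a : ZMod (p ^ e)) = χ ((-(a : ZMod (p ^ e))) ^ 4) := by rw [h4]
      _ = (ε * ζ) ^ 4 := by rw [map_pow, hχ]
      _ = ζ := by
        rw [mul_pow, show (4 : ℕ) = 3 + 1 by norm_num, pow_add ζ, hζ, one_mul, pow_one]
        rcases hε with rfl | rfl <;> norm_num

/-- `6 φ(p^(e-1)) < φ(p^e)` for an odd prime power `p^e ≠ 7`, `p ≠ 3`, whose unit group has an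
element of order `3`. [folklore] -/
theorem six_mul_totient_lt {p e : ℕ} (hp : p.Prime) (hp2 : p ≠ 2) (hp3 : p ≠ 3) (he : 1 ≤ e)
    (h3 : 3 ∣ (p ^ e).totient) (h7 : p ^ e ≠ 7) :
    6 * (p ^ (e - 1)).totient < (p ^ e).totient := by
  have hφe : (p ^ e).totient = p ^ (e - 1) * (p - 1) := Nat.totient_prime_pow hp (by omega)
  rw [hφe] at h3 ⊢
  -- `3 ∣ p - 1`, so `6 ∣ p - 1` and `p ≥ 7`
  have h31 : 3 ∣ p - 1 := by
    have hc : Nat.Coprime 3 (p ^ (e - 1)) :=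
      Nat.Coprime.pow_right _ ((Nat.coprime_primes Nat.prime_three hp).mpr (Ne.symm hp3))
    exact hc.dvd_of_dvd_mul_left h3
  have hpodd : Odd p := hp.odd_of_ne_two hp2
  have hp7 : 7 ≤ p := by
    have h5 := hp.two_le
    obtain ⟨k, hk⟩ := hpodd
    obtain ⟨j, hj⟩ := h31
    omega
  rcases Nat.lt_or_ge e 2 with he2 | he2
  · have he1 : e = 1 := by omega
    subst he1
    have hne7 : p ≠ 7 := fun h ↦ h7 (by rw [h, pow_one])
    simp only [Nat.sub_self, pow_zero, Nat.totient_one, mul_one, one_mul]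
    obtain ⟨k, hk⟩ := hpodd
    obtain ⟨j, hj⟩ := h31
    omega
  · have hφ : (p ^ (e - 1)).totient = p ^ (e - 1 - 1) * (p - 1) :=
      Nat.totient_prime_pow hp (by omega)
    rw [hφ]
    have hpow : p ^ (e - 1) = p ^ (e - 1 - 1) * p := by
      rw [← pow_succ]; congr 1; omega
    rw [hpow]
    have hpos : 0 < p ^ (e - 1 - 1) * (p - 1) := Nat.mul_pos (pow_pos hp.pos _) (by omega)
    calc 6 * (p ^ (e - 1 - 1) * (p - 1)) < 7 * (p ^ (e - 1 - 1) * (p - 1)) :=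
          (Nat.mul_lt_mul_right hpos).mpr (by norm_num)
      _ ≤ p * (p ^ (e - 1 - 1) * (p - 1)) := Nat.mul_le_mul_right _ hp7
      _ = p ^ (e - 1 - 1) * p * (p - 1) := by ring

/-! ### Local triviality of `c` at primes `p ≠ 3` -/

/-- **The heart of Prop. 8.1**: at level `p^e · n` (`p ∉ {2?, 3}`... `p ≠ 3` prime, `n` odd or
`4 ∣ n`, not `(p^e, n) ∈ {(7, 3), (7, 4)}`), a unit `c` with `c³ = 1` on which every odd
primitive character is non-trivial must be `≡ 1 (mod p^e)`: otherwise `c mod p^e` has order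
`3` and fibre counting gives an odd primitive `χ = χ_{p^e} ⊠ ψ` with `χ(c) = 1`.
[cite: Aoki1983, Prop. 8.1] -/
theorem unitsMap_eq_one_of_cube {p e n : ℕ} [NeZero n] (hp : p.Prime) (hp3 : p ≠ 3) (he : 1 ≤ e)
    [NeZero (p ^ e)] (hcop : (p ^ e).Coprime n) (hn : Odd n ∨ 4 ∣ n)
    (h7 : p ^ e = 7 → n ≠ 3 ∧ n ≠ 4)
    (c : (ZMod (p ^ e * n))ˣ) (hc3 : c ^ 3 = 1)
    (hc : ∀ χ : DirichletCharacter ℂ (p ^ e * n), χ.Odd → χ.IsPrimitive → χ c ≠ 1) :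
    ZMod.unitsMap (dvd_mul_right (p ^ e) n) c = 1 := by
  classical
  haveI : NeZero (p ^ e * n) := ⟨mul_ne_zero (NeZero.ne _) (NeZero.ne n)⟩
  haveI : Fact (Nat.Prime 3) := ⟨Nat.prime_three⟩
  by_contra hne
  set cq := ZMod.unitsMap (dvd_mul_right (p ^ e) n) c with hcq
  set cn := ZMod.unitsMap (dvd_mul_left n (p ^ e)) c with hcn
  have hcq3 : cq ^ 3 = 1 := by rw [hcq, ← map_pow, hc3, map_one]
  have hcn3 : cn ^ 3 = 1 := by rw [hcn, ← map_pow, hc3, map_one]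
  have hord : orderOf cq = 3 := orderOf_eq_prime hcq3 hne
  have h3card : 3 ∣ (p ^ e).totient := by
    rw [← ZMod.card_units_eq_totient, ← hord]; exact orderOf_dvd_card
  -- `p ≠ 2`
  have hp2 : p ≠ 2 := by
    rintro rfl
    rw [Nat.totient_prime_pow Nat.prime_two (by omega)] at h3card
    have : 3 ∣ 2 ^ (e - 1) := by simpa using h3card
    have := Nat.Prime.dvd_of_dvd_pow Nat.prime_three this
    omega
  -- a primitive character `ψ` mod `n`: even if possible
  obtain ⟨ψ, η, hψpar, hψprim, hηε⟩ : ∃ (ψ : DirichletCharacter ℂ n) (η : ℂ), ψ (-1) = η ∧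
      ψ.IsPrimitive ∧ ((η = 1 ∧ (n ≠ 3 ∧ n ≠ 4)) ∨ (η = -1 ∧ (n = 3 ∨ n = 4))) := by
    by_cases h34 : n = 3 ∨ n = 4
    · have hn1 : n ≠ 1 := by rcases h34 with rfl | rfl <;> norm_num
      have hn12 : n ≠ 12 := by rcases h34 with rfl | rfl <;> norm_num
      obtain ⟨ψ, ho, hpr⟩ := exists_odd_isPrimitive hn hn1 hn12
      exact ⟨ψ, -1, ho, hpr, Or.inr ⟨rfl, h34⟩⟩
    · rw [not_or] at h34
      obtain ⟨ψ, hev, hpr⟩ := exists_even_isPrimitive hn h34.1 h34.2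
      exact ⟨ψ, 1, hev, hpr, Or.inl ⟨rfl, h34⟩⟩
  -- the target values at `p^e`
  set ζ : ℂ := ψ (cn : ZMod n) ^ 2 with hζ
  have hψ3 : ψ (cn : ZMod n) ^ 3 = 1 := by
    rw [← map_pow, ← Units.val_pow_eq_pow_val, hcn3, Units.val_one, map_one]
  have hζ3 : ζ ^ 3 = 1 := by
    rw [hζ, ← pow_mul, show 2 * 3 = 3 * 2 by norm_num, pow_mul, hψ3, one_pow]
  have hζψ : ζ * ψ (cn : ZMod n) = 1 := by rw [hζ, ← pow_succ, hψ3]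
  set ε : ℂ := -η with hεdef
  have hε : ε = 1 ∨ ε = -1 := by
    rcases hηε with ⟨rfl, -⟩ | ⟨rfl, -⟩
    · right; rfl
    · left; rw [hεdef]; norm_num
  -- a primitive `χ_q` mod `p^e` with parity `ε` and `χ_q(cq) = ζ`
  obtain ⟨χq, hqprim, hqpar, hqval⟩ : ∃ χq : DirichletCharacter ℂ (p ^ e), χq.IsPrimitive ∧
      χq (-1) = ε ∧ χq (cq : ZMod (p ^ e)) = ζ := by
    by_cases h7' : p ^ e = 7
    · refine exists_isPrimitive_neg_one_apply_cube_seven hp h7' hord hε hζ3 ?_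
      rintro ⟨hε1, -⟩
      rcases hηε with ⟨rfl, -⟩ | ⟨-, h34⟩
      · rw [hεdef] at hε1; norm_num at hε1
      · obtain ⟨h3', h4'⟩ := h7 h7'
        rcases h34 with rfl | rfl
        · exact h3' rfl
        · exact h4' rfl
    · exact exists_isPrimitive_neg_one_apply_cube hp he
        (six_mul_totient_lt hp hp2 hp3 he h3card h7') hord hε hζ3
  -- the global character `χ_q ⊠ ψ` is odd, primitive and trivial at `c`
  have hodd : (DirichletCharacter.changeLevel (dvd_mul_right (p ^ e) n) χq *
      DirichletCharacter.changeLevel (dvd_mul_left n (p ^ e)) ψ).Odd := by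
    rw [DirichletCharacter.Odd, prodChar_neg_one, hqpar, hψpar, hεdef]
    rcases hηε with ⟨rfl, -⟩ | ⟨rfl, -⟩ <;> norm_num
  have hprim := prodChar_isPrimitive hcop hqprim hψprim
  have hval : (DirichletCharacter.changeLevel (dvd_mul_right (p ^ e) n) χq *
      DirichletCharacter.changeLevel (dvd_mul_left n (p ^ e)) ψ) c = 1 := by
    rw [prodChar_apply, ← coe_unitsMap, ← coe_unitsMap, ← hcq, ← hcn, hqval, hζψ]
  exact hc _ hodd hprim hval

/-! ### From local triviality to divisibility of `(c - 1)` -/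

/-- Local triviality at `p ≠ 3` as a divisibility: `p^(e_p) ∣ (c - 1)` (as the canonical
representative), for `c³ = 1` detected by all odd primitive characters mod `f`
(`f` odd or `4 ∣ f`, `f ∉ {21, 28}`). [cite: Aoki1983, Prop. 8.1] -/
theorem ordProj_dvd_val_sub_one {f : ℕ} [NeZero f] (hval : Odd f ∨ 4 ∣ f) (h21 : f ≠ 21)
    (h28 : f ≠ 28) (c : (ZMod f)ˣ) (hc3 : c ^ 3 = 1)
    (hc : ∀ χ : DirichletCharacter ℂ f, χ.Odd → χ.IsPrimitive → χ c ≠ 1)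
    {p : ℕ} (hp : p.Prime) (hpf : p ∣ f) (hp3 : p ≠ 3) :
    p ^ f.factorization p ∣ ((c : ZMod f) - 1).val := by
  classical
  have hf0 : f ≠ 0 := NeZero.ne f
  obtain ⟨e, he⟩ : ∃ e, f.factorization p = e := ⟨_, rfl⟩
  have he1 : 1 ≤ e := he ▸ hp.factorization_pos_of_dvd hf0 hpf
  have hcop0 : Nat.Coprime p (f / p ^ e) := he ▸ Nat.coprime_ordCompl hp hf0
  rw [he]
  obtain ⟨n, hfn⟩ : ∃ n, f = p ^ e * n :=
    ⟨f / p ^ e, by rw [← he]; exact (Nat.ordProj_mul_ordCompl_eq_self f p).symm⟩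
  have hpe0 : p ^ e ≠ 0 := pow_ne_zero e hp.ne_zero
  have hn0 : n ≠ 0 := fun h0 ↦ hf0 (by rw [hfn, h0, mul_zero])
  haveI : NeZero n := ⟨hn0⟩
  haveI : NeZero (p ^ e) := ⟨hpe0⟩
  have hdiv : p ^ e * n / p ^ e = n := Nat.mul_div_cancel_left n (Nat.pos_of_ne_zero hpe0)
  rw [hfn, hdiv] at hcop0
  have hcop : (p ^ e).Coprime n := Nat.Coprime.pow_left e hcop0
  subst hfn
  -- validity of the cofactor `n`
  have hnval : Odd n ∨ 4 ∣ n := by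
    by_cases hp2 : p = 2
    · subst hp2
      left
      have h2n : Nat.Coprime 2 n := Nat.Coprime.coprime_dvd_left (dvd_pow_self 2 (by omega)) hcop
      have : ¬ 2 ∣ n := (Nat.Prime.coprime_iff_not_dvd Nat.prime_two).mp h2n
      exact Nat.odd_iff.mpr (by omega)
    · rcases hval with ho | h4
      · exact Or.inl (Nat.Odd.of_mul_right ho)
      · right
        have hc' : Nat.Coprime (2 ^ 2) (p ^ e) :=
          Nat.Coprime.pow 2 e ((Nat.coprime_primes Nat.prime_two hp).mpr (Ne.symm hp2))
        exact (show Nat.Coprime 4 (p ^ e) by simpa using hc').dvd_of_dvd_mul_left h4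
  have h7 : p ^ e = 7 → n ≠ 3 ∧ n ≠ 4 := fun h7 ↦
    ⟨fun h3 ↦ h21 (by rw [h7, h3]), fun h4 ↦ h28 (by rw [h7, h4])⟩
  have key := unitsMap_eq_one_of_cube hp hp3 he1 hcop hnval h7 c hc3 hc
  -- translate `c ≡ 1 (mod p^e)` into the divisibility
  have hcast : ZMod.castHom (dvd_mul_right (p ^ e) n) (ZMod (p ^ e)) ((c : ZMod (p ^ e * n)) - 1) = 0 := by
    rw [map_sub, ← coe_unitsMap, key, Units.val_one, map_one, sub_self]
  rw [ZMod.castHom_apply, ZMod.cast_eq_val, ZMod.natCast_eq_zero_iff] at hcast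
  exact hcast

/-- Local information at `3`: `3^(e₃ - 1) ∣ (c - 1)` and `3 ∣ (c - 1)` for `c³ = 1`, `3 ∣ f`.
[folklore] -/
theorem threePow_dvd_val_sub_one {f : ℕ} [NeZero f] (h3 : 3 ∣ f) (c : (ZMod f)ˣ)
    (hc3 : c ^ 3 = 1) :
    3 ^ (f.factorization 3 - 1) ∣ ((c : ZMod f) - 1).val ∧ 3 ∣ ((c : ZMod f) - 1).val := by
  classical
  have hf0 : f ≠ 0 := NeZero.ne f
  constructor
  · obtain ⟨e, he⟩ : ∃ e, f.factorization 3 = e := ⟨_, rfl⟩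
    have he1 : 1 ≤ e := he ▸ Nat.prime_three.factorization_pos_of_dvd hf0 h3
    rw [he]
    obtain ⟨n, hfn⟩ : ∃ n, f = 3 ^ e * n :=
      ⟨f / 3 ^ e, by rw [← he]; exact (Nat.ordProj_mul_ordCompl_eq_self f 3).symm⟩
    have hn0 : n ≠ 0 := fun h0 ↦ hf0 (by rw [hfn, h0, mul_zero])
    haveI : NeZero n := ⟨hn0⟩
    haveI : NeZero (3 ^ e) := ⟨pow_ne_zero e three_ne_zero⟩
    haveI : NeZero (3 ^ (e - 1)) := ⟨pow_ne_zero _ three_ne_zero⟩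
    subst hfn
    set c₃ := ZMod.unitsMap (dvd_mul_right (3 ^ e) n) c with hc₃
    have hc₃3 : c₃ ^ 3 = 1 := by rw [hc₃, ← map_pow, hc3, map_one]
    have key := unitsMap_eq_one_of_pow_three_eq_one he1 c₃ hc₃3
    have hd : 3 ^ (e - 1) ∣ 3 ^ e * n := dvd_trans (pow_dvd_pow 3 (Nat.sub_le e 1)) (dvd_mul_right _ _)
    have key' : ZMod.unitsMap hd c = 1 := by
      have := congrArg (fun g ↦ g c) (ZMod.unitsMap_comp (pow_dvd_pow 3 (Nat.sub_le e 1))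
        (dvd_mul_right (3 ^ e) n))
      simp only [MonoidHom.comp_apply] at this
      rw [← this, ← hc₃, key]
    have hcast : ZMod.castHom hd (ZMod (3 ^ (e - 1))) ((c : ZMod (3 ^ e * n)) - 1) = 0 := by
      rw [map_sub, ← coe_unitsMap, key', Units.val_one, map_one, sub_self]
    rw [ZMod.castHom_apply, ZMod.cast_eq_val, ZMod.natCast_eq_zero_iff] at hcast
    exact hcast
  · have hcast : ZMod.castHom h3 (ZMod 3) ((c : ZMod f) - 1) = 0 := by
      rw [map_sub, castHom_three_eq_one_of_pow_three h3 c hc3, map_one, sub_self]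
    rw [ZMod.castHom_apply, ZMod.cast_eq_val, ZMod.natCast_eq_zero_iff] at hcast
    exact hcast

/-! ### Aoki's Proposition 8.1 -/

/-- **[Aoki1983, Prop. 8.1] (true form).** Let `f` be odd or divisible by `4`,
`f ∉ {1, 12, 15, 20, 21, 28}`, and `a, b ∈ (ℤ/f)ˣ` with `1 + χ(a) + χ(b) = 0` for all odd
primitive `χ` mod `f`. Then `9 ∣ f` and, for some `c ≠ 1` with `c³ = 1`, `c ≡ 1 (mod f/3)`:
`a ∈ {c, cu}` and `b ∈ {c², c²u}` where `u = f/2 - 1` (only when `4 ∣ f`).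
[cite: Aoki1983, Prop. 8.1] -/
theorem triple_structure {f : ℕ} [NeZero f] (hval : Odd f ∨ 4 ∣ f) (h1 : f ≠ 1) (h12 : f ≠ 12)
    (h15 : f ≠ 15) (h20 : f ≠ 20) (h21 : f ≠ 21) (h28 : f ≠ 28) (a b : (ZMod f)ˣ)
    (h : ∀ χ : DirichletCharacter ℂ f, χ.Odd → χ.IsPrimitive → 1 + χ a + χ b = 0) :
    9 ∣ f ∧ ∃ c : (ZMod f)ˣ, c ^ 3 = 1 ∧ c ≠ 1 ∧
      (∀ hd : f / 3 ∣ f, ZMod.unitsMap hd c = 1) ∧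
      ((a : ZMod f) = c ∨ (4 ∣ f ∧ (a : ZMod f) = c * (((f / 2 : ℕ) : ZMod f) - 1))) ∧
      ((b : ZMod f) = (c : ZMod f) ^ 2 ∨
        (4 ∣ f ∧ (b : ZMod f) = (c : ZMod f) ^ 2 * (((f / 2 : ℕ) : ZMod f) - 1))) := by
  classical
  have hf0 : f ≠ 0 := NeZero.ne f
  -- Step 1: values of characters
  have hv := fun χ (ho : DirichletCharacter.Odd χ) (hp : DirichletCharacter.IsPrimitive χ) ↦
    charvals_of_triple (h χ ho hp)
  -- Step 2: `a⁶ = 1`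
  have ha3U : ∀ χ : DirichletCharacter ℂ f, χ.Odd → χ.IsPrimitive →
      χ ((a ^ 3 : (ZMod f)ˣ) : ZMod f) = 1 := fun χ ho hp ↦ (hv χ ho hp).2.2.1
  have hk2 : ((a ^ 3 : (ZMod f)ˣ) : ZMod f) ^ 2 = 1 :=
    sq_eq_one_of_forall_odd_isPrimitive hval h15 h20 (a ^ 3) ha3U
  have ha6 : a ^ 6 = 1 := by
    apply Units.ext
    have : ((a ^ 6 : (ZMod f)ˣ) : ZMod f) = ((a ^ 3 : (ZMod f)ˣ) : ZMod f) ^ 2 := by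
      rw [← Units.val_pow_eq_pow_val, ← pow_mul]
    rw [this, hk2, Units.val_one]
  -- Step 3: `c = a⁴`
  set c : (ZMod f)ˣ := a ^ 4 with hcdef
  have hc3 : c ^ 3 = 1 := by
    rw [hcdef, ← pow_mul, show 4 * 3 = 6 * 2 by norm_num, pow_mul, ha6, one_pow]
  have hcχ : ∀ χ : DirichletCharacter ℂ f, χ.Odd → χ.IsPrimitive →
      χ (c : ZMod f) = χ (a : ZMod f) := by
    intro χ ho hp
    rw [hcdef, show a ^ 4 = a ^ 3 * a by rw [pow_succ], Units.val_mul, map_mul, ha3U χ ho hp,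
      one_mul]
  have hcne : ∀ χ : DirichletCharacter ℂ f, χ.Odd → χ.IsPrimitive → χ (c : ZMod f) ≠ 1 := by
    intro χ ho hp h1'
    have hA := (hv χ ho hp).1
    rw [← hcχ χ ho hp, h1'] at hA
    norm_num at hA
  obtain ⟨χ₀, hχ₀o, hχ₀p⟩ := exists_odd_isPrimitive hval h1 h12
  have hc1 : c ≠ 1 := fun h1' ↦ hcne χ₀ hχ₀o hχ₀p (by rw [h1', Units.val_one, map_one])
  clear_value c
  -- Step 4: divisibility of `x = (c - 1).val`
  set x := ((c : ZMod f) - 1).val with hx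
  have hxlt : x < f := ZMod.val_lt _
  have hloc : ∀ p : ℕ, p.Prime → p ∣ f → p ≠ 3 → p ^ f.factorization p ∣ x :=
    fun p hp hpf hp3 ↦ ordProj_dvd_val_sub_one hval h21 h28 c hc3 hcne hp hpf hp3
  -- Step 5: `9 ∣ f`
  have h9 : 9 ∣ f := by
    by_contra h9
    have hfx : f ∣ x := by
      rw [Nat.dvd_iff_prime_pow_dvd_dvd]
      intro p k hp hpk
      rcases Nat.eq_zero_or_pos k with rfl | hk
      · simp
      have hpf : p ∣ f := dvd_trans (dvd_pow_self p hk.ne') hpk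
      by_cases hp3 : p = 3
      · subst hp3
        have hk1 : k = 1 := by
          by_contra hk1
          exact h9 (dvd_trans (pow_dvd_pow 3 (show 2 ≤ k by omega)) hpk)
        subst hk1
        rw [pow_one]
        exact (threePow_dvd_val_sub_one hpf c hc3).2
      · have hle : k ≤ f.factorization p := (hp.pow_dvd_iff_le_factorization hf0).mp hpk
        exact dvd_trans (pow_dvd_pow p hle) (hloc p hp hpf hp3)
    have hx0 : x = 0 := Nat.eq_zero_of_dvd_of_lt hfx hxlt
    apply hc1
    apply Units.ext
    rw [Units.val_one]
    have : (c : ZMod f) - 1 = 0 := by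
      rw [← ZMod.natCast_zmod_val ((c : ZMod f) - 1), ← hx, hx0, Nat.cast_zero]
    exact sub_eq_zero.mp this
  have h3 : 3 ∣ f := dvd_trans (by norm_num) h9
  -- Step 6: `c ≡ 1 (mod f/3)`
  have hker : ∀ hd : f / 3 ∣ f, ZMod.unitsMap hd c = 1 := by
    intro hd
    haveI : NeZero (f / 3) := ⟨fun h0 ↦ by
      have := Nat.div_mul_cancel h3; rw [h0, zero_mul] at this; exact hf0 this.symm⟩
    have hfx : f / 3 ∣ x := by
      rw [Nat.dvd_iff_prime_pow_dvd_dvd]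
      intro p k hp hpk
      rcases Nat.eq_zero_or_pos k with rfl | hk
      · simp
      have hpf3 : p ∣ f / 3 := dvd_trans (dvd_pow_self p hk.ne') hpk
      have hpf : p ∣ f := dvd_trans hpf3 hd
      by_cases hp3 : p = 3
      · subst hp3
        have hk1 : 3 ^ (k + 1) ∣ f := by
          rw [pow_succ, ← Nat.div_mul_cancel h3]
          exact Nat.mul_dvd_mul_right hpk 3
        have hle : k + 1 ≤ f.factorization 3 :=
          (Nat.prime_three.pow_dvd_iff_le_factorization hf0).mp hk1
        exact dvd_trans (pow_dvd_pow 3 (by omega)) (threePow_dvd_val_sub_one h3 c hc3).1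
      · have hle : k ≤ f.factorization p :=
          (hp.pow_dvd_iff_le_factorization hf0).mp (dvd_trans hpk hd)
        exact dvd_trans (pow_dvd_pow p hle) (hloc p hp hpf hp3)
    apply Units.ext
    rw [coe_unitsMap, Units.val_one]
    have : ZMod.castHom hd (ZMod (f / 3)) ((c : ZMod f) - 1) = 0 := by
      rw [ZMod.castHom_apply, ZMod.cast_eq_val, ZMod.natCast_eq_zero_iff, ← hx]
      exact hfx
    rwa [map_sub, map_one, sub_eq_zero] at this
  refine ⟨h9, c, hc3, hc1, hker, ?_, ?_⟩
  · -- Step 7a: `a = c k` with `k = a³ ∈ {1, u}`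
    have hk := coe_eq_of_forall_odd_isPrimitive f hval h15 h20 (a ^ 3) ha3U
    have hak : (a : ZMod f) = (c : ZMod f) * ((a ^ 3 : (ZMod f)ˣ) : ZMod f) := by
      rw [hcdef]
      push_cast
      have : (a : ZMod f) ^ 6 = 1 := by
        have := congrArg (fun u : (ZMod f)ˣ ↦ (u : ZMod f)) ha6
        simpa using this
      linear_combination (-(a : ZMod f)) * this
    rcases hk with h1' | ⟨h4, hu⟩ | ⟨-, h9', -⟩ | ⟨-, -, h9', -⟩
    · left; rw [hak, h1', mul_one]
    · right; exact ⟨h4, by rw [hak, hu]⟩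
    · exact absurd h9 h9'
    · exact absurd h9 h9'
  · -- Step 7b: `b = w a²` with `w = b a⁻² ∈ {1, u}`, and `a² = c²`
    have hwU : ∀ χ : DirichletCharacter ℂ f, χ.Odd → χ.IsPrimitive →
        χ ((b * (a ^ 2)⁻¹ : (ZMod f)ˣ) : ZMod f) = 1 := fun χ ho hp ↦ (hv χ ho hp).2.2.2
    have hw := coe_eq_of_forall_odd_isPrimitive f hval h15 h20 (b * (a ^ 2)⁻¹) hwU
    have ha2 : ((a ^ 2 : (ZMod f)ˣ) : ZMod f) = (c : ZMod f) ^ 2 := by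
      rw [hcdef]
      push_cast
      have : (a : ZMod f) ^ 6 = 1 := by
        have := congrArg (fun u : (ZMod f)ˣ ↦ (u : ZMod f)) ha6
        simpa using this
      linear_combination (-(a : ZMod f) ^ 2) * this
    have hbw : (b : ZMod f) = ((b * (a ^ 2)⁻¹ : (ZMod f)ˣ) : ZMod f) * (c : ZMod f) ^ 2 := by
      rw [← ha2, ← Units.val_mul, inv_mul_cancel_right]
    rcases hw with h1' | ⟨h4, hu⟩ | ⟨-, h9', -⟩ | ⟨-, -, h9', -⟩
    · left; rw [hbw, h1', one_mul]
    · right; exact ⟨h4, by rw [hbw, hu, mul_comm]⟩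
    · exact absurd h9 h9'
    · exact absurd h9 h9'

end FermatCharacter

end Literature.AlgebraicGeometry.HodgeTheory
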